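import Summits.ABC.StewartYu.PadicTwistFunctions
import Summits.ABC.StewartYu.PadicCW77HalfStep
import Summits.ABC.StewartYu.TwistHalfPointAlgebra
import Mathlib.NumberTheory.Padics.Complex
import HarnessLib

/-!
# Cell abc-stewartyu, WP-Y provider B (ix): the values of `φ` at the half points, read in `ℂ_p`

`Summits/ABC/StewartYu/PadicTwistPMHalfValues.lean` — cell `abc-stewartyu`, seat p3 (crux `W80OneModFour`
stmt-ABC-19487; memo-05 §3). ADD-ON on p2's re-landed any-order twist chain: raw half-point values
(`exp_ψ_half_natCast_raw`, `Dw_half`, `termΦ_half_raw`, `Φ_half_raw` — any twist order, principal square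
roots kept), `Φ_eq_filter_support`, the value READ IN `ℂ_p` and split along `ι` (`Φ_half_complex_split`, by
p3's `TwistHalf.sum_prod_twist_eq`), the two halves as evaluations of signed class-sum vectors
(`half_sum_eq_evL`), and the root data `ŝᵢ := psqrt(ωᵢ)·ξ^{−rᵢ}` (`exists_root_data`). Kernel-checked
beforehand in HOME/p3/lean/pm/CHECK_PM_chain.lean. [folklore].
-/

noncomputable section

open NormedSpace Finset IsUltrametricDist
open Literature.NumberTheory.Transcendental
open Literature.NumberTheory.Transcendental.CW77.Setup (Idx Tau tauNorm)
open Literature.NumberTheory.Transcendental.PadicCW77.Setup (DwQ)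
open scoped Nat

namespace Summit.ABC.StewartYu

/-! ## HalfStepPM (provider B), part 1 — the values at the half points in `ℚ_p`, for ANY twist order
(generic replacements of p2's provider-A `exp_ψ_half_natCast` / `termΦ_half` / `Φ_half`: no `(G+1)/2`,
the principal square roots `psqrt(ωᵢ)` are kept as they are; provider B rewrites them in `ℂ_p`). -/

namespace TwistSetup

variable {p : ℕ} [Fact p.Prime] (S : TwistSetup p) {h Lb : ℕ}

/-- **`exp (s ψ_u / 2) = ∏ᵢ psqrt(ωᵢ)^{expnᵢ(u,s)}`** (raw form, any twist order): the value at the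
half point `s/2` lies on the PRINCIPAL square roots of the twisted generators. [folklore] -/
theorem exp_ψ_half_natCast_raw (u : Idx S.d h Lb) (s : ℕ) :
    exp (S.ψ u * ((2 : ℚ_[p])⁻¹ * (s : ℚ_[p]))) =
      ∏ i : Fin (S.d + 1), PadicExp.psqrt (S.ω i) ^ S.frame.expn u s i := by
  have e : S.ψ u * ((2 : ℚ_[p])⁻¹ * (s : ℚ_[p])) =
      ∑ i : Fin (S.d + 1), (S.frame.expn u s i : ℚ_[p]) * ((2 : ℚ_[p])⁻¹ * S.lgAll i) := by
    rw [show S.ψ u * ((2 : ℚ_[p])⁻¹ * (s : ℚ_[p])) = (2 : ℚ_[p])⁻¹ * (S.ψ u * s) by ring,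
      S.ψ_mul_natCast, mul_sum]
    exact sum_congr rfl fun i _ => by ring
  rw [e, PadicExp.exp_sum_of_norm_le S.hp3 univ _ fun i _ => ?_]
  · refine prod_congr rfl fun i _ => ?_
    unfold lgAll
    exact PadicExp.exp_natCast_mul_half_plog S.hp3 (S.norm_one_sub_ω_le i) _
  · rw [norm_mul]
    refine (mul_le_of_le_one_left (norm_nonneg _) ?_).trans ?_
    · exact_mod_cast Padic.norm_int_le_one (p := p) (S.frame.expn u s i : ℤ)
    · unfold lgAll
      rw [PadicExp.norm_inv_two_mul_plog S.hp3 (S.norm_one_sub_ω_le i)]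
      exact S.norm_one_sub_ω_le i


/-- (local copy of p2's `TwistSetup.DwQ_half_eq_frame`, PadicTwistHalfStep.lean — generic over the frame)
`DwQ (2^{J₀−J}) r l h τ₀ (s/2) = 2^{τ₀} · qΔ_{J+1}(s)` for `J < J₀`. [folklore] -/
theorem DwQ_half_eq_frame' (F : CW77.Setup) {h Lb : ℕ} {J₀ J : ℕ} (hJ : J < J₀) (u : Idx F.d h Lb)
    (τ₀ s : ℕ) :
    PadicCW77.Setup.DwQ (2 ^ (J₀ - J)) (u.1.1 : ℕ) (u.1.2 : ℕ) h τ₀ ((s : ℚ) / 2) =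
      2 ^ τ₀ * F.qΔ J₀ (J + 1) u τ₀ s := by
  apply Rat.cast_injective (α := ℂ)
  have h1 := F.Qw_wOf_half hJ u τ₀ s
  rw [CW77.Setup.Qw_zero_right] at h1
  push_cast
  rw [← h1]
  unfold PadicCW77.Setup.DwQ CW77.Setup.wOf
  rw [← Waldschmidt1980.map_wScaled, Polynomial.iterate_derivative_map, Polynomial.eval_map,
    show ((s : ℂ) / 2) = algebraMap ℚ ℂ ((s : ℚ) / 2) by simp, Polynomial.eval₂_at_apply]
  simp

/-- **`Dw τ₀ (s/2) = 2^{τ₀} · qΔ_{J+1}(s)`** in `ℚ_p` (`J < J₀`; p2's `DwQ_half_eq_frame` for the frame).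
[folklore] -/
theorem Dw_half {J₀ J : ℕ} (hJ : J < J₀) (u : Idx S.d h Lb) (τ₀ s : ℕ) :
    S.Dw J₀ J u τ₀ ((2 : ℚ_[p])⁻¹ * (s : ℚ_[p])) =
      (2 : ℚ_[p]) ^ τ₀ * (S.frame.qΔ J₀ (J + 1) u τ₀ s : ℚ_[p]) := by
  have hx : ((2 : ℚ_[p])⁻¹ * (s : ℚ_[p])) = (((s : ℚ) / 2 : ℚ) : ℚ_[p]) := by
    push_cast; ring
  rw [hx, S.Dw_ratCast, DwQ_half_eq_frame' S.frame hJ]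
  push_cast; ring

/-- One term at a half point (raw form): `termΦ(s/2) = 2^{τ₀} · (qΔ_{J+1} qA)(u) · ∏ᵢ psqrt(ωᵢ)^{expnᵢ(u,s)}`
(`J < J₀`). [folklore] -/
theorem termΦ_half_raw {J₀ J : ℕ} (hJ : J < J₀) (u : Idx S.d h Lb) (τ : Tau S.d) (s : ℕ) :
    S.termΦ J₀ J u τ ((2 : ℚ_[p])⁻¹ * (s : ℚ_[p])) =
      (2 : ℚ_[p]) ^ τ.1 * ((S.frame.qΔ J₀ (J + 1) u τ.1 s * S.frame.qA u τ.2 : ℚ) : ℚ_[p]) *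
        ∏ i : Fin (S.d + 1), PadicExp.psqrt (S.ω i) ^ S.frame.expn u s i := by
  unfold termΦ
  rw [S.Dw_half hJ, S.A_eq, S.exp_ψ_half_natCast_raw]
  push_cast; ring

/-- **The value of `φ_{J,τ}` at a half point, raw form** (`J < J₀`, any coefficient vector `c`):
`φ(c)(s/2) = 2^{τ₀} · ∑_u c(u) · (qΔ_{J+1} qA)(u) · ∏ᵢ psqrt(ωᵢ)^{expnᵢ(u,s)}`. [folklore] -/
theorem Φ_half_raw {J₀ J : ℕ} (hJ : J < J₀) (box : Finset (Idx S.d h Lb)) (c : Idx S.d h Lb → ℤ)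
    (τ : Tau S.d) (s : ℕ) :
    S.Φ J₀ J box c τ ((2 : ℚ_[p])⁻¹ * (s : ℚ_[p])) =
      (2 : ℚ_[p]) ^ τ.1 * ∑ u ∈ box, (c u : ℚ_[p]) *
        ((S.frame.qΔ J₀ (J + 1) u τ.1 s * S.frame.qA u τ.2 : ℚ) : ℚ_[p]) *
        ∏ i : Fin (S.d + 1), PadicExp.psqrt (S.ω i) ^ S.frame.expn u s i := by
  unfold Φ
  rw [mul_sum]
  refine sum_congr rfl fun u _ => ?_
  rw [S.termΦ_half_raw hJ]
  ring

end TwistSetup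


namespace TwistSetup

variable {p : ℕ} [Fact p.Prime] (S : TwistSetup p) {h Lb : ℕ}

open Classical in
/-- `φ` over a box equals `φ` over the SUPPORT of its coefficient vector inside the box (the provider
applies parts 2–3 to `box.filter (c ≠ 0)`, where the ± exponent class holds). [folklore] -/
theorem Φ_eq_filter_support (J₀ J : ℕ) (box : Finset (Idx S.d h Lb)) (c : Idx S.d h Lb → ℤ)
    (τ : Tau S.d) (z : ℚ_[p]) :
    S.Φ J₀ J box c τ z = S.Φ J₀ J (box.filter fun u => c u ≠ 0) c τ z := by
  unfold Φ
  rw [sum_filter]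
  refine sum_congr rfl fun u _ => ?_
  by_cases h0 : c u = 0
  · simp [h0]
  · rw [if_pos h0]

end TwistSetup
/-! ## HalfStepPM (provider B), part 2 — the value at a half point READ IN `ℂ_p` and split along `ι`
(memo-05 §3): with `ŝᵢ ξ^{rᵢ} = psqrt(ωᵢ)` in `ℂ_p`, `ξ^M = ι`, `ι² = −1` and the exponent class
`∑ rᵢ·expnᵢ(u,s) = c₀ + k(u)·M` on the box, `φ(c)(s/2) = 2^{τ₀} · ξ^{c₀} · (Σ₀ + ι·Σ₁)` where
`Σ_b = evL ŝ (C_b)` are evaluations of SIGNED class-sum vectors on the algebraic square roots `ŝᵢ`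
(`ŝᵢ² = allᵢ`). The separation/Liouville of `Σ₀ + ι Σ₁` is `TwistHalf.eq_zero_of_evL_add_iota_mul_eq_zero`
/ `TwistHalf.norm_evL_add_iota_mul_ge` (landed). -/

namespace TwistSetup

variable {p : ℕ} [Fact p.Prime] (S : TwistSetup p) {h Lb : ℕ}

/-- **`φ(c)(s/2)` in `ℂ_p`, split along `ι`.** [folklore] -/
theorem Φ_half_complex_split {J₀ J : ℕ} (hJ : J < J₀) (box : Finset (Idx S.d h Lb))
    (c : Idx S.d h Lb → ℤ) (τ : Tau S.d) (s : ℕ) (ŝ : Fin (S.d + 1) → ℂ_[p]) (ξ ιC : ℂ_[p])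
    (r : Fin (S.d + 1) → ℕ) {M c₀ : ℕ} (k : Idx S.d h Lb → ℕ)
    (hσ : ∀ i, algebraMap ℚ_[p] ℂ_[p] (PadicExp.psqrt (S.ω i)) = ŝ i * ξ ^ r i)
    (hι : ξ ^ M = ιC) (hι2 : ιC ^ 2 = -1)
    (hcls : ∀ u ∈ box, ∑ i, r i * S.frame.expn u s i = c₀ + k u * M) :
    algebraMap ℚ_[p] ℂ_[p] (S.Φ J₀ J box c τ ((2 : ℚ_[p])⁻¹ * (s : ℚ_[p]))) =
      (2 : ℂ_[p]) ^ τ.1 * (ξ ^ c₀ *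
        ((∑ u ∈ box.filter (fun u => Even (k u)),
            ((-1) ^ (k u / 2) * ((c u : ℂ_[p]) *
              ((S.frame.qΔ J₀ (J + 1) u τ.1 s * S.frame.qA u τ.2 : ℚ) : ℂ_[p]))) *
              ∏ i, ŝ i ^ S.frame.expn u s i) +
          ιC * ∑ u ∈ box.filter (fun u => ¬ Even (k u)),
            ((-1) ^ (k u / 2) * ((c u : ℂ_[p]) *
              ((S.frame.qΔ J₀ (J + 1) u τ.1 s * S.frame.qA u τ.2 : ℚ) : ℂ_[p]))) *
              ∏ i, ŝ i ^ S.frame.expn u s i)) := by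
  classical
  rw [S.Φ_half_raw hJ, map_mul, map_pow, map_ofNat, map_sum]
  congr 1
  have hterm : ∀ u ∈ box, algebraMap ℚ_[p] ℂ_[p] ((c u : ℚ_[p]) *
      ((S.frame.qΔ J₀ (J + 1) u τ.1 s * S.frame.qA u τ.2 : ℚ) : ℚ_[p]) *
      ∏ i : Fin (S.d + 1), PadicExp.psqrt (S.ω i) ^ S.frame.expn u s i) =
      ((c u : ℂ_[p]) * ((S.frame.qΔ J₀ (J + 1) u τ.1 s * S.frame.qA u τ.2 : ℚ) : ℂ_[p])) *
        ∏ i, (ŝ i * ξ ^ r i) ^ S.frame.expn u s i := by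
    intro u _
    rw [map_mul, map_mul, map_prod, map_intCast, map_ratCast]
    congr 1
    exact prod_congr rfl fun i _ => by rw [map_pow, hσ i]
  rw [sum_congr rfl hterm]
  exact TwistHalf.sum_prod_twist_eq box _ (fun u i => S.frame.expn u s i) ŝ ξ ιC r k hι hι2 hcls

/-- **The two halves are evaluations of signed class-sum vectors** on the algebraic roots `ŝᵢ`
(`ŝᵢ² = allᵢ`), by p3's `SetupQ.sum_prod_root_pow_eq_evL` (any field): for either parity filter `B'`,
`∑_{u ∈ B'} (−1)^{⌊k/2⌋} c(u) (qΔ_{J+1}qA)(u) ∏ ŝᵢ^{expn} = evL ŝ (T' ↦ ∑_{u ∈ B', Sset u s = T'} p_B'(u)·(qΔqA·qEh)(u))`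
with the INTEGER weights `p_B'(u) = (−1)^{⌊k(u)/2⌋} c(u)`. [folklore] -/
theorem half_sum_eq_evL {J₀ J : ℕ} (B' : Finset (Idx S.d h Lb)) (c : Idx S.d h Lb → ℤ) (τ : Tau S.d)
    (s : ℕ) (ŝ : Fin (S.d + 1) → ℂ_[p]) (hŝ : ∀ i, ŝ i * ŝ i = (S.toQ.all i : ℂ_[p]))
    (k : Idx S.d h Lb → ℕ) :
    ∑ u ∈ B', ((-1) ^ (k u / 2) * ((c u : ℂ_[p]) *
        ((S.frame.qΔ J₀ (J + 1) u τ.1 s * S.frame.qA u τ.2 : ℚ) : ℂ_[p]))) *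
        ∏ i, ŝ i ^ S.frame.expn u s i =
      Multiquad.evL ŝ (fun T' => ∑ u ∈ B' with S.toQ.flat.Sset u s = T',
        (((-1) ^ (k u / 2) * c u : ℤ) : ℚ) *
          ((S.frame.qΔ J₀ (J + 1) u τ.1 s * S.frame.qA u τ.2) * S.toQ.qEh u s)) := by
  rw [← S.toQ.sum_prod_root_pow_eq_evL ŝ hŝ B' (fun u => (-1) ^ (k u / 2) * c u)
    (fun u => S.frame.qΔ J₀ (J + 1) u τ.1 s * S.frame.qA u τ.2) s]
  refine sum_congr rfl fun u _ => ?_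
  push_cast
  ring

end TwistSetup


/-! ## HalfStepPM (provider B), part 7 — the `ℂ_p` root data from `(ζ, r, ξ)`: the algebraic square
roots `ŝᵢ := psqrt(ωᵢ)·ξ^{−rᵢ}` of the rational generators, with `hσ`, `hŝ`, `hŝ1` of parts 2–6. -/

namespace TwistSetup

variable {p : ℕ} [Fact p.Prime] (S : TwistSetup p) {h Lb : ℕ}

/-- **The root data.** If `ηᵢ = ζ^{rᵢ}` and `ξ² = ζ` in `ℂ_p` with `‖ξ‖ = 1`, then
`ŝᵢ := psqrt(ωᵢ)·(ξ^{rᵢ})⁻¹` satisfies `ŝᵢ·ξ^{rᵢ} = psqrt(ωᵢ)`, `ŝᵢ² = allᵢ`, `‖ŝᵢ‖ ≤ 1`. [folklore] -/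
theorem exists_root_data {ζ : ℚ_[p]} (r : Fin (S.d + 1) → ℕ) (hη : ∀ i, S.η i = ζ ^ r i)
    {ξ : ℂ_[p]} (hξ2 : ξ ^ 2 = algebraMap ℚ_[p] ℂ_[p] ζ) (hξ : ‖ξ‖ = 1) :
    ∃ ŝ : Fin (S.d + 1) → ℂ_[p],
      (∀ i, algebraMap ℚ_[p] ℂ_[p] (PadicExp.psqrt (S.ω i)) = ŝ i * ξ ^ r i) ∧
      (∀ i, ŝ i * ŝ i = (S.toQ.all i : ℂ_[p])) ∧ (∀ i, ‖ŝ i‖ ≤ 1) := by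
  have hξ0 : ξ ≠ 0 := fun h0 => by rw [h0, norm_zero] at hξ; exact zero_ne_one hξ
  have hξr : ∀ i, ξ ^ r i ≠ 0 := fun i => pow_ne_zero _ hξ0
  refine ⟨fun i => algebraMap ℚ_[p] ℂ_[p] (PadicExp.psqrt (S.ω i)) * (ξ ^ r i)⁻¹, ?_, ?_, ?_⟩
  · intro i; rw [mul_assoc, inv_mul_cancel₀ (hξr i), mul_one]
  · intro i
    have hsq : PadicExp.psqrt (S.ω i) * PadicExp.psqrt (S.ω i) = S.ω i :=
      PadicExp.psqrt_mul_self S.hp3 (S.norm_one_sub_ω_le i)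
    have hω : algebraMap ℚ_[p] ℂ_[p] (S.ω i) =
        (S.toQ.all i : ℂ_[p]) * (ξ ^ r i) ^ 2 := by
      unfold ω
      rw [map_mul, hη i, map_pow, ← hξ2, map_ratCast, ← pow_mul, ← pow_mul, mul_comm 2]
    calc algebraMap ℚ_[p] ℂ_[p] (PadicExp.psqrt (S.ω i)) * (ξ ^ r i)⁻¹ *
          (algebraMap ℚ_[p] ℂ_[p] (PadicExp.psqrt (S.ω i)) * (ξ ^ r i)⁻¹)
        = algebraMap ℚ_[p] ℂ_[p] (PadicExp.psqrt (S.ω i) * PadicExp.psqrt (S.ω i)) *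
            ((ξ ^ r i)⁻¹) ^ 2 := by rw [map_mul]; ring
      _ = (S.toQ.all i : ℂ_[p]) := by
          rw [hsq, hω, inv_pow, mul_assoc, mul_inv_cancel₀ (pow_ne_zero _ (hξr i)), mul_one]
  · intro i
    rw [norm_mul, norm_inv, norm_pow, hξ, one_pow, inv_one, mul_one,
      show algebraMap ℚ_[p] ℂ_[p] (PadicExp.psqrt (S.ω i)) = ((PadicExp.psqrt (S.ω i) : ℚ_[p]) : ℂ_[p])
        from rfl, PadicComplex.norm_extends', PadicExp.norm_psqrt S.hp3 (S.norm_one_sub_ω_le i)]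

end TwistSetup


end Summit.ABC.StewartYu

end
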